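import Summits.ABC.ABC.Theorems.IsogenyGlueCongruenceDegreePrimesPolyBoundedNewPartEquivalence
import Summits.ABC.ABC.Theorems.IsogenyGlueCongruenceDegreePrimesPolyBoundedStubOldLevelCongruence
import HarnessLib

/-!
# Crux A `DegreePrimesPolyBounded` (stmt-ABC-2045), line `newpart-congruence-friability` — the socket
# is the crux, with every hypothesis a route item or a named published fact

The registered bet of skeleton v2 (lead c3) is the socket `stub_newPartPrimesOfDatum` of the landed
frame: *new-partner congruence primes of the datum of a semistable curve are `≤ C N^κ`*.  The landed
equivalence `newPartPrimesOfDatum_iff_degreePrimesPolyBounded` (p106321) carries the old-level Galois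
input `hGal` as a raw Hecke-algebra hypothesis; the landed `stub_oldLevelCongruence_of_galoisFacts`
(p102794) discharges `hGal` from two published facts in Galois vocabulary (Mazur 1978 Thm 4; the
mod-`λ` representation of a weight-2 `Γ₀(M)`-newform, Deligne–Serre / Eichler–Shimura).  Composing
the two gives the certificate behind the lead's `promote-stub` verdict: modulo the route items
`ModularDatumExists` (stmt-ABC-15126) and `MazurKenkuBound` (stmt-ABC-15125), the two Galois facts and
the printed same-level inputs `SameLevelCongruenceFacts` of the K-line, the socket, crux A and the
same-level piece `KSameLevel` of crux K are EQUIVALENT — nothing registered on this line is smaller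
than the crux.
-/

set_option linter.dupNamespace false

noncomputable section

open scoped MatrixGroups ModularForm
open CongruenceSubgroup
open Literature.NumberTheory.EllipticCurves.ModularForms
open Summit.ABC.ABC.Theses.IsogenyGlueCongruence
open Summit.ABC.ABC.Theorems.IGCTorsionSharing

namespace Summit.ABC.ABC.Theorems.DegreePrimesPolyBounded

/-- REGISTERED STUB (lead c3) — **the socket is the crux, over named facts only**: given the route
items `ModularDatumExists`, `MazurKenkuBound`, Mazur 1978 Thm 4 (`hMazur`: semistable `E/ℚ`,
`ℓ ≥ 11` ⟹ `E[ℓ]` irreducible), the mod-`λ` Galois representation of a weight-2 newform (`hDS`) and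
the printed same-level inputs `SameLevelCongruenceFacts`, the socket `NewPartPrimesOfDatum` of the
line is equivalent to `DegreePrimesPolyBounded`. [folklore] -/
theorem stub_socketIffCrux_of_facts :
    ModularDatumExists → MazurKenkuBound →
    (∀ (W : WeierstrassCurve ℚ) [W.IsElliptic], W.IsSemistable ℤ →
      ∀ ℓ : ℕ, ℓ.Prime → 11 ≤ ℓ → W.HasIrreducibleModPGaloisRep ℓ) →
    (∀ (M : ℕ) [NeZero M] (g : CuspForm (Gamma0 M) 2), IsNewform0 g →
      ∀ (ℓ : ℕ) [Fact ℓ.Prime] (S : Finset ℕ), (∀ q : ℕ, q.Prime → q ∣ M * ℓ → q ∈ S) →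
      ∀ (R : Subring ℂ)
        (hR : ∀ q : ℕ, q.Prime → q ∉ S → (UpperHalfPlane.qExpansion 1 ⇑g).coeff q ∈ R)
        (k : Type) [Field k] [CharP k ℓ] [TopologicalSpace k] [DiscreteTopology k]
        (ψ : R →+* k),
      ∃ ρ : Literature.NumberTheory.GaloisRepresentations.FramedGaloisRep ℚ k 2,
        ρ.toGaloisRep.IsSemisimple ∧
        (∀ v : IsDedekindDomain.HeightOneSpectrum (NumberField.RingOfIntegers ℚ),
          ¬ ((Rat.HeightOneSpectrum.primesEquiv v : Nat.Primes) : ℕ) ∣ M * ℓ → ρ.IsUnramifiedAt v) ∧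
        ∀ (v : IsDedekindDomain.HeightOneSpectrum (NumberField.RingOfIntegers ℚ))
          (hv : ((Rat.HeightOneSpectrum.primesEquiv v : Nat.Primes) : ℕ) ∉ S),
          ρ.HasFrobCharpolyAt v (Polynomial.X ^ 2 - Polynomial.C (ψ
            ⟨(UpperHalfPlane.qExpansion 1 ⇑g).coeff ((Rat.HeightOneSpectrum.primesEquiv v : Nat.Primes) : ℕ),
              hR _ (Rat.HeightOneSpectrum.primesEquiv v).2 hv⟩) * Polynomial.X +
            Polynomial.C ((((Rat.HeightOneSpectrum.primesEquiv v : Nat.Primes) : ℕ) : k)))) →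
    SameLevelCongruenceFacts →
    ((∃ κ C : ℝ, ∀ (N : ℕ) [NeZero N] (W : WeierstrassCurve ℚ) [W.IsElliptic] [W.IsGloballyMinimal],
      W.IsSemistable ℤ → W.conductorNorm ℤ = N →
      ∀ (D : ModularParametrizationData W N) (g : CuspForm (Gamma0 N) 2), IsNewform0 g →
        eigenIdeal g ≠ eigenIdeal D.f →
        ∀ ℓ : ℕ, ℓ.Prime → ℓ ∣ heckeCongruenceModulus D.f (eigenIdeal g) →
          (ℓ : ℝ) ≤ C * (N : ℝ) ^ κ) ↔ DegreePrimesPolyBounded) := by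
  intro hmod hMK hMazur hDS hF
  exact newPartPrimesOfDatum_iff_degreePrimesPolyBounded hmod hMK
    (stub_oldLevelCongruence_of_galoisFacts hMazur hDS) hF

/-- **Crux A ⟺ the same-level piece of crux K, over named facts only** (same inputs;
`kSameLevel_iff_degreePrimesPolyBounded` with `hGal` discharged by p102794). [folklore] -/
theorem kSameLevel_iff_degreePrimesPolyBounded_of_facts (hmod : ModularDatumExists)
    (hMK : MazurKenkuBound)
    (hMazur : ∀ (W : WeierstrassCurve ℚ) [W.IsElliptic], W.IsSemistable ℤ →
      ∀ ℓ : ℕ, ℓ.Prime → 11 ≤ ℓ → W.HasIrreducibleModPGaloisRep ℓ)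
    (hDS : ∀ (M : ℕ) [NeZero M] (g : CuspForm (Gamma0 M) 2), IsNewform0 g →
      ∀ (ℓ : ℕ) [Fact ℓ.Prime] (S : Finset ℕ), (∀ q : ℕ, q.Prime → q ∣ M * ℓ → q ∈ S) →
      ∀ (R : Subring ℂ)
        (hR : ∀ q : ℕ, q.Prime → q ∉ S → (UpperHalfPlane.qExpansion 1 ⇑g).coeff q ∈ R)
        (k : Type) [Field k] [CharP k ℓ] [TopologicalSpace k] [DiscreteTopology k]
        (ψ : R →+* k),
      ∃ ρ : Literature.NumberTheory.GaloisRepresentations.FramedGaloisRep ℚ k 2,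
        ρ.toGaloisRep.IsSemisimple ∧
        (∀ v : IsDedekindDomain.HeightOneSpectrum (NumberField.RingOfIntegers ℚ),
          ¬ ((Rat.HeightOneSpectrum.primesEquiv v : Nat.Primes) : ℕ) ∣ M * ℓ → ρ.IsUnramifiedAt v) ∧
        ∀ (v : IsDedekindDomain.HeightOneSpectrum (NumberField.RingOfIntegers ℚ))
          (hv : ((Rat.HeightOneSpectrum.primesEquiv v : Nat.Primes) : ℕ) ∉ S),
          ρ.HasFrobCharpolyAt v (Polynomial.X ^ 2 - Polynomial.C (ψ
            ⟨(UpperHalfPlane.qExpansion 1 ⇑g).coeff ((Rat.HeightOneSpectrum.primesEquiv v : Nat.Primes) : ℕ),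
              hR _ (Rat.HeightOneSpectrum.primesEquiv v).2 hv⟩) * Polynomial.X +
            Polynomial.C ((((Rat.HeightOneSpectrum.primesEquiv v : Nat.Primes) : ℕ) : k))))
    (hF : SameLevelCongruenceFacts) :
    KSameLevel ↔ DegreePrimesPolyBounded :=
  kSameLevel_iff_degreePrimesPolyBounded hmod hMK (stub_oldLevelCongruence_of_galoisFacts hMazur hDS) hF

end Summit.ABC.ABC.Theorems.DegreePrimesPolyBounded

end
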